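import Literature.RepresentationTheory.HeisenbergGroup.SchrodingerPiOperators
import Literature.NumberTheory.Weil1964.LocalWeilIndexQuadraticForm
import HarnessLib

/-!
# Weil's identity `r(w) r(n(s)) r(w) = γ · r(n(-s⁻¹)) r(m(s)) r(w) r(n(-s⁻¹))` on `𝒮(F^ι)` (Rao Thm 4.1 (4))

Topic `RepresentationTheory/HeisenbergGroup`; namespace `Literature.RepresentationTheory.HeisenbergGroup`. KERNEL
mathematics only (definitions with bodies + theorems; no named fact, no `axiom`, no `sorry`).

[Rangarao1993, Thm 4.1 (4), p. 358]: "`c(τ u_ρ, τ) = Weil index of χ(½(x, xρ)) = γ(f_{u,β})`", with the comment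
(p. 359) "since the formulas for `r(τ)`, `r(τ u_ρ)` and `r(τ u_ρ τ)` are explicitly known the identity
`r(τ) r(u_ρ) r(τ) = c(τ u_ρ, τ) r(τ u_ρ τ)` leads quickly to a Fourier transform relation — which is the defining
property of the Weil index"; that relation is [Weil1964, Chap. I n° 14, Thm 2] (the Fourier transform of a
non-degenerate character of the second degree `ψ(f(x))` is `γ(f) |ρ|^{-1/2} ψ(-f'(x*))`) and its operator form
[Weil1964, Chap. I n° 15, Thm 3] (`r(s) r(s') = γ(f₀) r(s″)` on the big cell).

For `F` non-archimedean local with `2` invertible, `ψ` continuous non-trivial of conductor exponent `m`, `μ` a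
SELF-DUAL Haar measure on `F`, `S ∈ GL(F^ι)` SYMMETRIC for `⟨·,·⟩`, and the normalised standard operators of
`SchrodingerPiOperators.lean` (`r(n(c)) = unipOpPi`, `r(m(a)) = leviOpPi`, `r(w) = fourierOpPi`) we PROVE the
operator identity on `𝒮(F^ι)`

  `r(w) ∘ r(n(S)) ∘ r(w) = κ(S) · r(n(-S⁻¹)) ∘ r(m(S)) ∘ r(w) ∘ r(n(-S⁻¹))`,
  `κ(S) = g(-q_S) · |det S|^{1/2}`,  `q_S(x) = ½⟨x, Sx⟩`,

where `g(-q_S)` is Weil's stable Gauss integral `weilGaussQF` of [Weil1964, Chap. II n° 27] for the product measure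
(`LocalWeilIndexQuadraticForm.lean`) — so `κ(S) = γ(-q_S) · (|g(-q_S)| |det S|^{1/2})` is the Weil index up to the
positive factor which is `1` for the self-dual measure ([Weil1964, Chap. I n° 14 Thm 2 Cor. 2]).  The group-theoretic
content is the `SL₂`-type factorisation `w n(S) w = n(-S⁻¹) m(S) w n(-S⁻¹)` (valid exactly when `S` is invertible,
i.e. when `w n(S) w` lies in the big cell `P w P`), proved here in `Sp(F^ι ⊕ F^ι)` as well
(`weyl_mul_unipotent_mul_weyl`).

Proof (Weil's, loc. cit.): for `Φ ∈ 𝒮(F^ι)` both `Φ` and `Φ̂` vanish off a box; on a large box `D` Fubini applies,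
the inner integral `∫_D ψ(⟨y, z + x⟩ - q_S(y)) dy` is `ψ(q_{S⁻¹}(z + x)) ∫_D ψ(-q_S(y - S⁻¹(z+x))) dy` (completing
the square), the translate drops out because `D` is a subgroup containing `S⁻¹(z + x)`, and `∫_D ψ(-q_S) = g(-q_S)`
once `D` is past Weil's stabilisation threshold ([Weil1964, Chap. II n° 27]: "indépendant de `M` dès que `M` est
assez grand").

## References

* [Rangarao1993] R. Ranga Rao, Pacific J. Math. 157 (1993), Thm 4.1 (4) p. 358 and its proof p. 359; Thm 3.5.
* [Weil1964] A. Weil, Acta Math. 111 (1964): Chap. I n° 7 Prop. 1 and (9) (p. 153), n° 14 Thm 2, n° 15 Thm 3;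
  Chap. II n° 27.
-/

set_option autoImplicit false

noncomputable section

namespace Literature.RepresentationTheory.HeisenbergGroup

open _root_.MeasureTheory Matrix Set Filter
open scoped NNReal
open Literature.NumberTheory.Automorphic
open Literature.NumberTheory.GaloisRepresentations.IsNonarchimedeanLocalField
open Literature.NumberTheory.Weil1964

/-! ## §1 The quadratic form `-q_S = -½⟨x, Sx⟩` and the identities of completing the square -/

section Algebra

variable {F : Type*} [Field F] [Invertible (2 : F)] {ι : Type*} [Fintype ι]

/-- the quadratic form `-q_s(x) = -½⟨x, s x⟩` attached to a linear map `s` (as a Mathlib `QuadraticForm`, through the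
bilinear form `(x, y) ↦ -½⟨x, s y⟩`). [cite: Rangarao1993, Lemma 3.1 (q_σ), p. 351] -/
def negHalfQF (s : (ι → F) →ₗ[F] (ι → F)) : QuadraticForm F (ι → F) :=
  LinearMap.BilinMap.toQuadraticMap ((-⅟(2 : F)) • (dotProductBilin F F (m := ι)).compl₂ s)

/-- value `-q_s(x) = -½⟨x, s x⟩ = -halfForm s x`. [cite: Rangarao1993, Lemma 3.1, p. 351] -/
theorem negHalfQF_apply (s : (ι → F) →ₗ[F] (ι → F)) (x : ι → F) : negHalfQF s x = -halfForm s x := by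
  rw [negHalfQF, LinearMap.BilinMap.toQuadraticMap_apply, halfForm]
  simp only [LinearMap.smul_apply, LinearMap.compl₂_apply, smul_eq_mul]
  ring

omit [Invertible (2 : F)] in
/-- a vector pairing to zero with every vector is zero. [cite: Weil1964, Chap. I n° 6, p. 151] -/
private theorem eq_zero_of_forall_dotProduct_eq_zero {v : ι → F} (h : ∀ x : ι → F, v ⬝ᵥ x = 0) : v = 0 := by
  classical
  funext i
  have := h (Pi.single i 1)
  rw [dotProduct_comm, single_dotProduct, one_mul] at this
  rw [this, Pi.zero_apply]

/-- **`-q_S` is non-degenerate** for `S` symmetric and invertible. [cite: Rangarao1993, Thm 4.1 (4) ("ρ nondegenerate")] -/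
theorem separatingLeft_associated_negHalfQF (S : (ι → F) ≃ₗ[F] (ι → F))
    (hS : ∀ x y : ι → F, x ⬝ᵥ S y = y ⬝ᵥ S x) :
    (QuadraticMap.associated (R := F) (negHalfQF (S : (ι → F) →ₗ[F] (ι → F)))).SeparatingLeft := by
  have hsym : ∀ x y : ι → F, ((-⅟(2 : F)) • (dotProductBilin F F (m := ι)).compl₂ (S : (ι → F) →ₗ[F] (ι → F))) x y =
      ((-⅟(2 : F)) • (dotProductBilin F F (m := ι)).compl₂ (S : (ι → F) →ₗ[F] (ι → F))) y x := fun x y => by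
    simp only [LinearMap.smul_apply, LinearMap.compl₂_apply, smul_eq_mul, dotProductBilin_apply_apply,
      LinearEquiv.coe_coe, hS x y]
  rw [negHalfQF, QuadraticMap.associated, QuadraticMap.associated_left_inverse F hsym]
  intro x hx
  have key : ∀ y : ι → F, x ⬝ᵥ S y = 0 := by
    intro y
    have h := hx y
    simp only [LinearMap.smul_apply, LinearMap.compl₂_apply, smul_eq_mul, dotProductBilin_apply_apply,
      LinearEquiv.coe_coe, mul_eq_zero, neg_eq_zero] at h
    exact h.resolve_left (invertibleInvOf (a := (2 : F))).ne_zero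
  refine eq_zero_of_forall_dotProduct_eq_zero fun w => ?_
  have := key (S.symm w)
  rwa [LinearEquiv.apply_symm_apply] at this

omit [Invertible (2 : F)] in
/-- the inverse of a symmetric automorphism is symmetric. [cite: Rangarao1993, Thm 4.1 (4)] -/
theorem symm_dotProduct_of_dotProduct (S : (ι → F) ≃ₗ[F] (ι → F)) (hS : ∀ x y : ι → F, x ⬝ᵥ S y = y ⬝ᵥ S x)
    (x y : ι → F) : x ⬝ᵥ S.symm y = y ⬝ᵥ S.symm x := by
  have h := hS (S.symm x) (S.symm y)
  rw [LinearEquiv.apply_symm_apply, LinearEquiv.apply_symm_apply] at h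
  rw [dotProduct_comm x (S.symm y), ← h, dotProduct_comm]

/-- **completing the square**: `⟨y, v⟩ - q_S(y) = -q_S(y - S⁻¹v) + q_{S⁻¹}(v)` for `S` symmetric.
[cite: Weil1964, Chap. I n° 14, proof of Thm 2] -/
theorem dotProduct_sub_halfForm (S : (ι → F) ≃ₗ[F] (ι → F)) (hS : ∀ x y : ι → F, x ⬝ᵥ S y = y ⬝ᵥ S x)
    (y v : ι → F) :
    y ⬝ᵥ v - halfForm (S : (ι → F) →ₗ[F] (ι → F)) y =
      -halfForm (S : (ι → F) →ₗ[F] (ι → F)) (y - S.symm v) + halfForm (S.symm : (ι → F) →ₗ[F] (ι → F)) v := by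
  simp only [halfForm_apply, LinearEquiv.coe_coe, map_sub, LinearEquiv.apply_symm_apply, sub_dotProduct,
    dotProduct_sub]
  have h1 : S.symm v ⬝ᵥ S y = y ⬝ᵥ v := by rw [hS, LinearEquiv.apply_symm_apply]
  have h2 : S.symm v ⬝ᵥ v = v ⬝ᵥ S.symm v := dotProduct_comm _ _
  rw [h1, h2]
  have h3 : ⅟(2 : F) + ⅟(2 : F) = 1 := by rw [← two_mul, mul_invOf_self]
  linear_combination (-(y ⬝ᵥ v)) * h3

/-- the expansion `q_{S⁻¹}(z + x) = q_{S⁻¹}(z) + ⟨x, S⁻¹ z⟩ + q_{S⁻¹}(x)` for `S` symmetric.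
[cite: Weil1964, Chap. I n° 14, proof of Thm 2] -/
theorem halfForm_symm_add (S : (ι → F) ≃ₗ[F] (ι → F)) (hS : ∀ x y : ι → F, x ⬝ᵥ S y = y ⬝ᵥ S x) (z x : ι → F) :
    halfForm (S.symm : (ι → F) →ₗ[F] (ι → F)) (z + x) =
      halfForm (S.symm : (ι → F) →ₗ[F] (ι → F)) z + x ⬝ᵥ S.symm z +
        halfForm (S.symm : (ι → F) →ₗ[F] (ι → F)) x := by
  simp only [halfForm_apply, LinearEquiv.coe_coe, map_add, add_dotProduct, dotProduct_add]
  rw [symm_dotProduct_of_dotProduct S hS z x]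
  have h3 : ⅟(2 : F) + ⅟(2 : F) = 1 := by rw [← two_mul, mul_invOf_self]
  linear_combination (x ⬝ᵥ S.symm z) * h3

omit [Invertible (2 : F)] in
/-- `n(s)` is symplectic when `s` is symmetric (hypothesis of `unipotentSp` in `⬝ᵥ` form). [cite: Weil1964, n° 6, p. 151] -/
theorem unipotentSp_hyp_of_symm (s : (ι → F) →ₗ[F] (ι → F)) (hs : ∀ x y : ι → F, x ⬝ᵥ s y = y ⬝ᵥ s x) :
    ∀ x x' : ι → F, dotProductBilin F F x (s x') = dotProductBilin F F x' (s x) := fun x x' => by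
  rw [dotProductBilin_apply_apply, dotProductBilin_apply_apply, hs]

/-- **the factorisation `w n(S) w = n(-S⁻¹) m(S) w n(-S⁻¹)` in `Sp(F^ι ⊕ F^ι)`** for `S` symmetric invertible
(`w : (x, y) ↦ (y, -x)`, `n(c) : (x, y) ↦ (x, y + cx)`, `m(a) = (a, a⁻ᵀ)`) — the rank-`n` form of Weil's (9)
`d₀(-ρ⁻¹) t₀(f) d₀(ρ⁻¹) t₀(f⁻) = t₀(f'⁻¹) d₀'(-ρ⁻¹)`, i.e. of the `SL₂` identity
`(0 1; -1 0)(1 0; s 1)(0 1; -1 0) = (1 0; -s⁻¹ 1)(s 0; 0 s⁻¹)(0 1; -1 0)(1 0; -s⁻¹ 1)`.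
[cite: Weil1964, Chap. I n° 7, Prop. 1 and (9), p. 153] -/
theorem weyl_mul_unipotent_mul_weyl [DecidableEq ι] (S : (ι → F) ≃ₗ[F] (ι → F)) (hS : ∀ x y : ι → F, x ⬝ᵥ S y = y ⬝ᵥ S x) :
    weylSp (dotProductBilin F F (m := ι)) (LinearEquiv.refl F (ι → F)) (LinearEquiv.neg F) dotProductBilin_refl_neg' *
        unipotentSp (dotProductBilin F F (m := ι)) (S : (ι → F) →ₗ[F] (ι → F)) (unipotentSp_hyp_of_symm _ hS) *
        weylSp (dotProductBilin F F (m := ι)) (LinearEquiv.refl F (ι → F)) (LinearEquiv.neg F) dotProductBilin_refl_neg' =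
      unipotentSp (dotProductBilin F F (m := ι)) (-(S.symm : (ι → F) →ₗ[F] (ι → F)))
          (unipotentSp_hyp_of_symm _ fun x y => by
            simp only [LinearMap.neg_apply, dotProduct_neg, LinearEquiv.coe_coe, symm_dotProduct_of_dotProduct S hS x y]) *
        leviSp (dotProductBilin F F (m := ι)) S (dualLeviPi S) (dotProductBilin_apply_dualLeviPi S) *
        weylSp (dotProductBilin F F (m := ι)) (LinearEquiv.refl F (ι → F)) (LinearEquiv.neg F) dotProductBilin_refl_neg' *
        unipotentSp (dotProductBilin F F (m := ι)) (-(S.symm : (ι → F) →ₗ[F] (ι → F)))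
          (unipotentSp_hyp_of_symm _ fun x y => by
            simp only [LinearMap.neg_apply, dotProduct_neg, LinearEquiv.coe_coe, symm_dotProduct_of_dotProduct S hS x y]) := by
  apply Subtype.ext
  apply LinearEquiv.ext
  rintro ⟨x, y⟩
  -- `dualLeviPi S = S⁻¹` for symmetric `S`
  have hd : ∀ v : ι → F, dualLeviPi S v = S.symm v := by
    intro v
    classical
    refine (sub_eq_zero.1 (eq_zero_of_forall_dotProduct_eq_zero fun t => ?_))
    rw [sub_dotProduct, dotProduct_comm (dualLeviPi S v) t, dotProduct_dualLeviPi, dotProduct_comm,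
      symm_dotProduct_of_dotProduct S hS, dotProduct_comm, sub_self]
  simp only [Subgroup.coe_mul, LinearEquiv.mul_apply, coe_weylSp, weylσ_apply, coe_unipotentSp, unipotentσ_apply,
    coe_leviSp_apply, LinearEquiv.refl_apply, LinearEquiv.neg_apply, LinearMap.neg_apply, LinearEquiv.coe_coe,
    map_add, map_neg, LinearEquiv.apply_symm_apply, LinearEquiv.symm_apply_apply, hd, Prod.mk.injEq]
  constructor
  · abel
  · abel

end Algebra

/-! ## §2 The analytic identity -/

section Analysis

variable {F : Type*} [Field F] [ValuativeRel F] [TopologicalSpace F] [IsNonarchimedeanLocalField F]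
  {ι : Type*} [Fintype ι] [Invertible (2 : F)]
  {ψ : AddChar F Circle} (hl : IsLocallyConstant (⇑ψ : F → Circle))
  (hb : ∀ y : ι → F, Continuous fun u : ι → F => dotProductBilin F F u y)
  [MeasurableSpace F] [BorelSpace F] (μ : Measure F) [μ.IsAddHaarMeasure] {m : ℤ}

/-- **Weil's constant** `κ(S) = g(-q_S) |det S|^{1/2}` of the identity (for the self-dual measure this is the Weil
index `γ(-q_S)`: `|g(-q_S)| = |det S|^{-1/2}`). [cite: Weil1964, Chap. I n° 14, Thm 2; Rangarao1993, Thm 4.1 (4)] -/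
def weilKappa (S : (ι → F) ≃ₗ[F] (ι → F)) : ℂ :=
  weilGaussQF ψ μ (negHalfQF (S : (ι → F) →ₗ[F] (ι → F))) * (modSqrt S : ℂ)

/-- `κ(S) ≠ 0` for `S` symmetric (`g(-q_S) ≠ 0` for a non-degenerate form). [cite: Weil1964, Chap. II n° 27, p. 175] -/
theorem weilKappa_ne_zero (hψ : ψ.IsContinuousNontrivial) (S : (ι → F) ≃ₗ[F] (ι → F))
    (hS : ∀ x y : ι → F, x ⬝ᵥ S y = y ⬝ᵥ S x) : weilKappa μ (ψ := ψ) S ≠ 0 :=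
  mul_ne_zero (weilGaussQF_ne_zero μ hψ (separatingLeft_associated_negHalfQF S hS))
    (Complex.ofReal_ne_zero.2 (modSqrt_pos S).ne')

omit [Invertible (2 : F)] in
/-- translation of a set integral over a box: `∫_{y∈D} φ(y - u) = ∫_{y∈D} φ(y)` for `u ∈ D = (𝔭^N)^ι` (a subgroup)
and the product Haar measure. [cite: Weil1964, Chap. II n° 24, p. 172] -/
theorem setIntegral_piBox_sub (N : ℤ) {u : ι → F} (hu : u ∈ piPrimePowBall F ι N) (φ : (ι → F) → ℂ) :
    ∫ y in piPrimePowBall F ι N, φ (y - u) ∂(Measure.pi fun _ : ι => μ) =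
      ∫ y in piPrimePowBall F ι N, φ y ∂(Measure.pi fun _ : ι => μ) := by
  haveI : SecondCountableTopology F := secondCountableTopology_localField F
  have hD : MeasurableSet (piPrimePowBall F ι N) := measurableSet_piPrimePowBall N
  rw [← integral_indicator hD, ← integral_indicator hD]
  have e : (fun y => (piPrimePowBall F ι N).indicator (fun y => φ (y - u)) y) =
      fun y => (piPrimePowBall F ι N).indicator φ (y - u) := by
    funext y
    by_cases hy : y ∈ piPrimePowBall F ι N
    · rw [indicator_of_mem hy, indicator_of_mem]
      simpa [sub_eq_add_neg] using add_mem_piPrimePowBall hy (neg_mem_piPrimePowBall hu)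
    · have hy' : y - u ∉ piPrimePowBall F ι N := fun h => hy (by
        have := add_mem_piPrimePowBall h hu; rwa [sub_add_cancel] at this)
      rw [indicator_of_notMem hy, indicator_of_notMem hy']
  rw [e, integral_sub_right_eq_self]

/-- **the inner Gauss integral** (completing the square + translation): for `S` symmetric, a box `D ∋ S⁻¹ v`,
`∫_{y∈D} ψ(⟨y, v⟩ - q_S(y)) dy = ψ(q_{S⁻¹}(v)) · g(-q_S, D)`. [cite: Weil1964, Chap. I n° 14, proof of Thm 2] -/
theorem setIntegral_piBox_addChar_sub_halfForm (S : (ι → F) ≃ₗ[F] (ι → F))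
    (hS : ∀ x y : ι → F, x ⬝ᵥ S y = y ⬝ᵥ S x) (N : ℤ) (v : ι → F) (hv : S.symm v ∈ piPrimePowBall F ι N) :
    ∫ y in piPrimePowBall F ι N, ((ψ (y ⬝ᵥ v - halfForm (S : (ι → F) →ₗ[F] (ι → F)) y) : Circle) : ℂ)
        ∂(Measure.pi fun _ : ι => μ) =
      ((ψ (halfForm (S.symm : (ι → F) →ₗ[F] (ι → F)) v) : Circle) : ℂ) *
        gaussQF ψ μ (negHalfQF (S : (ι → F) →ₗ[F] (ι → F))) (piPrimePowBall F ι N) := by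
  have e : ∀ y, ((ψ (y ⬝ᵥ v - halfForm (S : (ι → F) →ₗ[F] (ι → F)) y) : Circle) : ℂ) =
      ((ψ (halfForm (S.symm : (ι → F) →ₗ[F] (ι → F)) v) : Circle) : ℂ) *
        psiQF ψ (negHalfQF (S : (ι → F) →ₗ[F] (ι → F))) (y - S.symm v) := by
    intro y
    rw [dotProduct_sub_halfForm S hS, psiQF_apply, negHalfQF_apply, ← coe_addChar_add, add_comm]
  simp_rw [e]
  rw [integral_const_mul, gaussQF_def,
    setIntegral_piBox_sub μ N hv (psiQF ψ (negHalfQF (S : (ι → F) →ₗ[F] (ι → F))))]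

/-- pointwise form of the left-hand side: `(r(w) r(n(S)) r(w) Φ)(z) = ∫ ψ(⟨y,z⟩) ψ(-q_S(y)) Φ̂(y) dy`.
[cite: Rangarao1993, Thm 4.1 (4) proof, p. 359] -/
theorem coe_fourier_unip_fourier_apply (hψ : ψ.IsContinuousNontrivial) (hm : ψ.HasConductorExp m)
    (s : (ι → F) →ₗ[F] (ι → F)) (f : SchwartzBruhat (ι → F)) (z : ι → F) :
    (((fourierOpPi μ hψ hm * unipOpPi hl s * fourierOpPi μ hψ hm :
        SchwartzBruhat (ι → F) ≃ₗ[ℂ] SchwartzBruhat (ι → F)) f : SchwartzBruhat (ι → F)) : (ι → F) → ℂ) z =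
      ∫ y, ((ψ (y ⬝ᵥ z) : Circle) : ℂ) * (((ψ (-halfForm s y) : Circle) : ℂ) *
        piFourierSB ψ (Measure.pi fun _ : ι => μ) f y) ∂(Measure.pi fun _ : ι => μ) := by
  rw [LinearEquiv.mul_apply, LinearEquiv.mul_apply, coe_fourierOpPi, piFourierSB_apply]
  refine integral_congr_ae (Eventually.of_forall fun y => ?_)
  simp only
  rw [coe_unipOpPi_apply, coe_fourierOpPi]

/-- pointwise form of the right-hand side:
`(r(n(-S⁻¹)) r(m(S)) r(w) r(n(-S⁻¹)) Φ)(z) = ψ(q_{S⁻¹}(z)) |det S|^{-1/2} ∫ ψ(⟨x, S⁻¹z⟩) ψ(q_{S⁻¹}(x)) Φ(x) dx`.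
[cite: Rangarao1993, Thm 4.1 (4) proof, p. 359] -/
theorem coe_unip_levi_fourier_unip_apply (hψ : ψ.IsContinuousNontrivial) (hm : ψ.HasConductorExp m)
    (S : (ι → F) ≃ₗ[F] (ι → F)) (f : SchwartzBruhat (ι → F)) (z : ι → F) :
    (((unipOpPi hl (-(S.symm : (ι → F) →ₗ[F] (ι → F))) * leviOpPi S * fourierOpPi μ hψ hm *
        unipOpPi hl (-(S.symm : (ι → F) →ₗ[F] (ι → F))) : SchwartzBruhat (ι → F) ≃ₗ[ℂ] SchwartzBruhat (ι → F)) f :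
          SchwartzBruhat (ι → F)) : (ι → F) → ℂ) z =
      ((ψ (halfForm (S.symm : (ι → F) →ₗ[F] (ι → F)) z) : Circle) : ℂ) * (((modSqrt S : ℂ))⁻¹ *
        ∫ x, ((ψ (x ⬝ᵥ S.symm z) : Circle) : ℂ) *
          (((ψ (halfForm (S.symm : (ι → F) →ₗ[F] (ι → F)) x) : Circle) : ℂ) * (f : (ι → F) → ℂ) x)
          ∂(Measure.pi fun _ : ι => μ)) := by
  rw [LinearEquiv.mul_apply, LinearEquiv.mul_apply, LinearEquiv.mul_apply, coe_unipOpPi_apply, coe_leviOpPi_apply,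
    coe_fourierOpPi, piFourierSB_apply, halfForm, halfForm]
  simp only [LinearMap.neg_apply, map_neg, mul_neg, neg_neg, coe_unipOpPi_apply, halfForm, LinearMap.neg_apply]

/-- **Weil's identity, pointwise**: for `S` symmetric, `μ` self-dual and `Φ ∈ 𝒮(F^ι)`,
`∫ ψ(⟨y,z⟩) ψ(-q_S(y)) Φ̂(y) dy = g(-q_S) ψ(q_{S⁻¹}(z)) ∫ ψ(⟨x, S⁻¹z⟩) ψ(q_{S⁻¹}(x)) Φ(x) dx`
(Fubini on a large box, completing the square, Weil's stabilisation of Gauss integrals over lattices).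
[cite: Weil1964, Chap. I n° 14, Thm 2; Chap. II n° 27] -/
theorem integral_addChar_negHalfForm_piFourierSB (hψ : ψ.IsContinuousNontrivial)
    (S : (ι → F) ≃ₗ[F] (ι → F)) (hS : ∀ x y : ι → F, x ⬝ᵥ S y = y ⬝ᵥ S x) (f : SchwartzBruhat (ι → F)) (z : ι → F) :
    ∫ y, ((ψ (y ⬝ᵥ z) : Circle) : ℂ) * (((ψ (-halfForm (S : (ι → F) →ₗ[F] (ι → F)) y) : Circle) : ℂ) *
        piFourierSB ψ (Measure.pi fun _ : ι => μ) f y) ∂(Measure.pi fun _ : ι => μ) =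
      weilGaussQF ψ μ (negHalfQF (S : (ι → F) →ₗ[F] (ι → F))) *
        (((ψ (halfForm (S.symm : (ι → F) →ₗ[F] (ι → F)) z) : Circle) : ℂ) *
          ∫ x, ((ψ (x ⬝ᵥ S.symm z) : Circle) : ℂ) *
            (((ψ (halfForm (S.symm : (ι → F) →ₗ[F] (ι → F)) x) : Circle) : ℂ) * (f : (ι → F) → ℂ) x)
            ∂(Measure.pi fun _ : ι => μ)) := by
  haveI : SecondCountableTopology F := secondCountableTopology_localField F
  set ν : Measure (ι → F) := Measure.pi fun _ : ι => μ with hν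
  set q : (ι → F) → F := halfForm (S : (ι → F) →ₗ[F] (ι → F)) with hq
  set q' : (ι → F) → F := halfForm (S.symm : (ι → F) →ₗ[F] (ι → F)) with hq'
  -- supports: `Φ` off `E = (𝔭^{nf})^ι`, `Φ̂` off `(𝔭^{ng})^ι`
  obtain ⟨nf, hnf⟩ := exists_eq_zero_of_notMem_piPrimePowBall f.2
  have hFf : piFourierSB ψ ν f ∈ SchwartzBruhat (ι → F) := piFourierSB_mem_schwartzBruhat ν hψ f.2
  obtain ⟨ng, hng⟩ := exists_eq_zero_of_notMem_piPrimePowBall hFf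
  -- Weil's stabilisation threshold for `-q_S`
  obtain ⟨ℓ, m₀, hmℓ, hstab⟩ := exists_forall_gaussQF_eq_weilGaussQF μ hψ
    (separatingLeft_associated_negHalfQF S hS)
  -- the compact set `S⁻¹(z + E)` lies in a box
  obtain ⟨N₁, hN₁⟩ := exists_subset_primePowPiBox_of_isCompact
    ((isCompact_piPrimePowBall (F := F) (ι := ι) nf).image
      ((S.symm.toLinearMap.continuous_on_pi).comp (continuous_const.add continuous_id) :
        Continuous fun x : ι → F => S.symm (z + x)))
  -- the big box `D = (𝔭^N)^ι`
  set N : ℤ := min (min ng m₀) N₁ with hN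
  set D : Set (ι → F) := piPrimePowBall F ι N with hD
  set E : Set (ι → F) := piPrimePowBall F ι nf with hE
  have hDmeas : MeasurableSet D := measurableSet_piPrimePowBall N
  have hEmeas : MeasurableSet E := measurableSet_piPrimePowBall nf
  have hDng : piPrimePowBall F ι ng ⊆ D := piPrimePowBall_antitone (by omega)
  have hDm₀ : primePowPiBox F ι m₀ ⊆ D := piPrimePowBall_antitone (by omega)
  have hDu : ∀ x ∈ E, S.symm (z + x) ∈ D := fun x hx =>
    piPrimePowBall_antitone (show N ≤ N₁ by omega) (hN₁ ⟨x, hx, rfl⟩)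
  have hgauss : gaussQF ψ μ (negHalfQF (S : (ι → F) →ₗ[F] (ι → F))) D =
      weilGaussQF ψ μ (negHalfQF (S : (ι → F) →ₗ[F] (ι → F))) :=
    hstab D (isCompact_piPrimePowBall N)
      (fun x hx h hh => add_mem_piPrimePowBall hx (piPrimePowBall_antitone (show N ≤ ℓ by omega) hh)) hDm₀
  -- Step 1: restrict the outer integral to `D`
  have step1 : ∫ y, ((ψ (y ⬝ᵥ z) : Circle) : ℂ) * (((ψ (-q y) : Circle) : ℂ) * piFourierSB ψ ν f y) ∂ν =
      ∫ y in D, ((ψ (y ⬝ᵥ z - q y) : Circle) : ℂ) * piFourierSB ψ ν f y ∂ν := by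
    rw [setIntegral_eq_integral_of_forall_compl_eq_zero fun y hy => by
      rw [hng y (fun h => hy (hDng h)), mul_zero]]
    refine integral_congr_ae (Eventually.of_forall fun y => ?_)
    simp only
    rw [sub_eq_add_neg, coe_addChar_add, mul_assoc]
  -- Step 2: write `Φ̂` as an integral over `E` and combine the characters
  have step2 : ∀ y, ((ψ (y ⬝ᵥ z - q y) : Circle) : ℂ) * piFourierSB ψ ν f y =
      ∫ x in E, ((ψ (y ⬝ᵥ (z + x) - q y) : Circle) : ℂ) * (f : (ι → F) → ℂ) x ∂ν := by
    intro y
    rw [piFourierSB_apply, ← integral_const_mul,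
      setIntegral_eq_integral_of_forall_compl_eq_zero fun x hx => by rw [hnf x hx, mul_zero]]
    refine integral_congr_ae (Eventually.of_forall fun x => ?_)
    simp only
    rw [← mul_assoc, ← coe_addChar_add, dotProduct_add, dotProduct_comm x y]
    ring_nf
  -- Step 3: Fubini on `D × E`
  have hfcont : Continuous (f : (ι → F) → ℂ) := (mem_schwartzBruhat_iff.1 f.2).1.continuous
  obtain ⟨C, hC⟩ := hfcont.bounded_above_of_compact_support (mem_schwartzBruhat_iff.1 f.2).2
  have hΦcont : Continuous fun p : (ι → F) × (ι → F) =>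
      ((ψ (p.1 ⬝ᵥ (z + p.2) - q p.1) : Circle) : ℂ) * (f : (ι → F) → ℂ) p.2 := by
    refine (continuous_subtype_val.comp (hψ.1.comp ?_)).mul (hfcont.comp continuous_snd)
    refine Continuous.sub ?_ ((continuous_halfForm _).comp continuous_fst)
    simp only [dotProduct]
    exact continuous_finsetSum _ fun i _ =>
      ((continuous_apply i).comp continuous_fst).mul ((continuous_apply i).comp (continuous_const.add continuous_snd))
  have hfin : ((ν.restrict D).prod (ν.restrict E)) univ ≠ ⊤ := by
    rw [Measure.prod_restrict, Measure.restrict_apply MeasurableSet.univ, univ_inter, Measure.prod_prod]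
    exact ENNReal.mul_ne_top (measure_piPrimePowBall_lt_top ν N).ne (measure_piPrimePowBall_lt_top ν nf).ne
  have hInt : Integrable (fun p : (ι → F) × (ι → F) =>
      ((ψ (p.1 ⬝ᵥ (z + p.2) - q p.1) : Circle) : ℂ) * (f : (ι → F) → ℂ) p.2) ((ν.restrict D).prod (ν.restrict E)) := by
    have h := Measure.integrableOn_of_bounded (μ := (ν.restrict D).prod (ν.restrict E)) (s := univ) hfin
      hΦcont.aestronglyMeasurable (M := C) (Eventually.of_forall fun p => by
        rw [norm_mul, Circle.norm_coe, one_mul]; exact hC p.2)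
    rwa [IntegrableOn, Measure.restrict_univ] at h
  have step3 : ∫ y in D, ∫ x in E, ((ψ (y ⬝ᵥ (z + x) - q y) : Circle) : ℂ) * (f : (ι → F) → ℂ) x ∂ν ∂ν =
      ∫ x in E, ∫ y in D, ((ψ (y ⬝ᵥ (z + x) - q y) : Circle) : ℂ) * (f : (ι → F) → ℂ) x ∂ν ∂ν := by
    rw [← integral_prod _ hInt, integral_prod_symm _ hInt]
  -- Step 4: the inner `y`-integral
  have step4 : ∀ x ∈ E, ∫ y in D, ((ψ (y ⬝ᵥ (z + x) - q y) : Circle) : ℂ) * (f : (ι → F) → ℂ) x ∂ν =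
      (f : (ι → F) → ℂ) x * ((ψ (q' (z + x)) : Circle) : ℂ) *
        weilGaussQF ψ μ (negHalfQF (S : (ι → F) →ₗ[F] (ι → F))) := by
    intro x hx
    rw [integral_mul_const, setIntegral_piBox_addChar_sub_halfForm μ S hS N (z + x) (hDu x hx), hgauss]
    ring
  -- Step 5: assemble
  rw [step1]
  simp_rw [step2]
  rw [step3, setIntegral_congr_fun hEmeas step4, integral_mul_const,
    setIntegral_eq_integral_of_forall_compl_eq_zero fun x hx => by rw [hnf x hx, zero_mul]]
  have e5 : ∀ x, (f : (ι → F) → ℂ) x * (((ψ (q' (z + x)) : Circle) : ℂ)) =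
      ((ψ (q' z) : Circle) : ℂ) * (((ψ (x ⬝ᵥ S.symm z) : Circle) : ℂ) *
        ((((ψ (q' x)) : Circle) : ℂ) * (f : (ι → F) → ℂ) x)) := by
    intro x
    rw [hq', halfForm_symm_add S hS z x, coe_addChar_add, coe_addChar_add]
    ring
  simp_rw [e5]
  rw [integral_const_mul]
  ring

/-- **WEIL'S IDENTITY / RAO THM 4.1 (4) AS AN OPERATOR IDENTITY ON `𝒮(F^ι)`**: for `S ∈ GL(F^ι)` symmetric, `ψ`
continuous non-trivial of conductor exponent `m` and `μ` SELF-DUAL,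

  `r(w) r(n(S)) r(w) = κ(S) · r(n(-S⁻¹)) r(m(S)) r(w) r(n(-S⁻¹))`,  `κ(S) = g(-q_S) |det S|^{1/2}`

(Rao: "`r(τ) r(u_ρ) r(τ) = c(τ u_ρ, τ) r(τ u_ρ τ)` … leads quickly to a Fourier transform relation — which is the
defining property of the Weil index"). [cite: Rangarao1993, Thm 4.1 (4), pp. 358–359; Weil1964, Chap. I n° 15, Thm 3] -/
theorem fourierOpPi_mul_unipOpPi_mul_fourierOpPi (hψ : ψ.IsContinuousNontrivial) (hm : ψ.HasConductorExp m)
    (S : (ι → F) ≃ₗ[F] (ι → F)) (hS : ∀ x y : ι → F, x ⬝ᵥ S y = y ⬝ᵥ S x) :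
    fourierOpPi μ hψ hm * unipOpPi hl (S : (ι → F) →ₗ[F] (ι → F)) * fourierOpPi μ hψ hm =
      scalarOp (Units.mk0 (weilKappa μ (ψ := ψ) S) (weilKappa_ne_zero μ hψ S hS)) *
        (unipOpPi hl (-(S.symm : (ι → F) →ₗ[F] (ι → F))) * leviOpPi S * fourierOpPi μ hψ hm *
          unipOpPi hl (-(S.symm : (ι → F) →ₗ[F] (ι → F)))) := by
  apply LinearEquiv.ext; intro f; apply Subtype.ext; funext z
  rw [coe_fourier_unip_fourier_apply, integral_addChar_negHalfForm_piFourierSB μ hψ S hS f z,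
    LinearEquiv.mul_apply, scalarOp_apply, Submodule.coe_smul, Pi.smul_apply, smul_eq_mul, Units.val_mk0,
    coe_unip_levi_fourier_unip_apply, weilKappa]
  have hm0 : ((modSqrt S : ℂ)) ≠ 0 := Complex.ofReal_ne_zero.2 (modSqrt_pos S).ne'
  field_simp

end Analysis

end Literature.RepresentationTheory.HeisenbergGroup
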